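/-
Copyright: lit-balaban Phase-2 proof seat p08 (gen 7).  Statement-level skeleton of a published paper; no proof claims beyond what
the kernel checks below.
-/
import Literature.MathematicalPhysics.QuantumFieldTheory.BalabanImbrieJaffe1984to88.BIJ88Ineq217NearSupport
import Literature.MathematicalPhysics.QuantumFieldTheory.BalabanImbrieJaffe1984to88.BIJ88Ineq217Torus
import Literature.MathematicalPhysics.QuantumFieldTheory.BalabanImbrieJaffe1984to88.BIJ85Sigma712Torus

/-!
# `BalabanImbrieJaffe1984to88.BIJ88Ineq217SigmaTorus` — T. Bałaban, J. Imbrie, A. Jaffe, *Effective action and cluster properties of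
the abelian Higgs model*, Commun. Math. Phys. **114** (1988) 257–315 [BalabanImbrieJaffe1988]: the input of the argument for **(2.17)**
p. 262, *"The near part is similarly bounded since σ_k is a bounded operator on curls [2]"*, DISCHARGED FOR THE TORUS σ_k OF RECORD — the
`ℓ²` operator bound `‖σ_kg‖ ≤ ‖Q^{e*}_k‖²‖g‖` for EVERY unit plaquette field `g` follows from [2] = [I] (4.2.7) `0 ≤ ⟨f, σ_kf⟩ ≤ ‖Q^{e*}_kf‖²`
(p30's `BIJ85Sigma421Torus.sigmaTorus_form_bounds`) and the symmetry of σ_k (p33's `BIJ85Sigma712Torus.inner_sigmaTorus_comm`) by the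
Cauchy–Schwarz inequality for the form `⟨·, σ_k·⟩` — so that gen 6's (2.17)-on-the-torus `BIJ88Ineq217NearSupport.abs_ineq217_torus_l2`
holds for the KERNEL OF p30's `sigmaTorus` with its hypothesis `hV2` («σ_k bounded on curls», `ℓ²` reading) PROVED; (2.16) stays displayed

statement-level skeleton of published theorems with citation tags; proofs where landed; nothing here is a claim about the Yang–Mills mass gap

PDF held: `paper:balaban1988-cmp114-bij-abelian-higgs-effective-action` (journal page = PDF page + 256), p. 262 [PDF 6] (text layer
`~/.lit/texts/…/p0006.txt`, re-read this session); [2] = [I] = [BalabanImbrieJaffe1985] (`paper:balaban1985-cmp97-bij-higgs-minimizers`),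
(4.2.7) p. 311 (*"As a consequence of the representation (4.2.4) for σ_k, we have 0 ≦ σ_k ≦ (2.21) [sic] I"* — the form bounds).

CITATION HEADER (lean-in-tree rule).  Part of the lit-balaban TYPED SKELETON (HOME `run/shared/lean/pub/lit-balaban/`), Phase-2 proof
seat p08 (gen 7), unit `lit-balaban-p08`; WHAT IS REPRODUCED = SKELETON row **C2.Eq2.17** (reader file `HOME/lit-balaban-r18/ROWS-C2.md`,
owner r18, referee ref-5; gen-6 cells p253429/p253816/p254138/p254664: the printed ARGUMENT with (2.16) and «σ_k bounded on curls» as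
displayed hypotheses), kind «model instance»: the «bounded on curls» hypothesis is now a THEOREM for the torus σ_k.  TAKING line
HOME/STATUS.md (gen 7, fourth target).

THE PRINTED TEXT (p. 262 [PDF 6], verbatim): *"we shall only encounter situations where f^{(k)}(p₂) = (∂A)(p₂) for p₂ near p₁. Then we
prove that (σ_kf^{(k)})(p₁) ≦ ‖f^{(k)}‖_∞ (2.17) as follows. Write f^{(k)} = ∂□A + f′, where □ is the characteristic function of a
neighborhood of p₂. The distant part (σ_kf′)(p₁) is easily estimated by ‖f^{(k)}‖_∞ by (2.16). The near part is similarly bounded since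
σ_k is a bounded operator on curls [2]. It was also shown in [2] that σ_k is bounded from below."*

THE TORUS DATA (all in the tree; standing range `k ≤ m + K`, `w = η^d > 0`, `c = η⁻¹ ≠ 0`, `2 ≤ d`): unit-lattice plaquette fields
`UnitPlaqSpace P k = EuclideanSpace ℝ (Plaq P k)` with `toU : (Plaq P k → ℝ) ≃ₗ UnitPlaqSpace P k` (p30), `σ_k = sigmaTorus hd w c k`
((I.4.2.1)–(I.4.2.2)), `Q^{e*}_k = QesOp hd w k`; gen 6's kernel calculus `applyK σ f p = Σ_q σ(p,q)f(q)`, `supNorm`, `pdist`, the near part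
`nearCurl`, the centred box `boxPlaqs (loOf z₁ R) (hiOf z₁ R)`.

WHAT IS PROVED (0 `sorry`, standard axioms; theorems only — proof lane):
* §1 `norm_le_of_form_le` — for a symmetric linear map `T` on a real inner product space with `0 ≤ ⟨f, Tf⟩ ≤ C‖f‖²`: `‖Tf‖ ≤ C‖f‖`
  (Cauchy–Schwarz for the nonnegative form `⟨·, T·⟩`, `inner_form_sq_le`).
* §2 **`norm_sigmaTorus_le`**: `‖σ_kf‖ ≤ ‖Q^{e*}_k‖²_op·‖f‖` for EVERY unit plaquette field `f` (so in particular on curls), from p30's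
  `sigmaTorus_form_bounds` (no zero modes `hD_holds`, p33) and p33's `inner_sigmaTorus_comm`; `sum_sq_sigmaTorus_le` (coordinates).
* §3 THE KERNEL OF σ_k: `applyK_sigmaKernel` (`applyK (p q ↦ (σ_k e_q)(p)) g = σ_k(toU g)` coordinatewise), **`hV2_sigmaTorus`** — gen 6's
  hypothesis `hV2` HOLDS for the kernel of `sigmaTorus` with `M = ‖Q^{e*}_k‖²_op`, for all `g` (a fortiori on `Set.range (curl c′)`).
* §4 **`abs_ineq217_sigmaTorus_l2`** — (2.17) ON THE TORUS FOR THE σ_k OF RECORD: for `f = ∂^{c′}A` on the box of radius `R` about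
  `p₁.src` and (2.16) for the kernel of σ_k at `p₁` beyond `R` (row sum `S`), `|(σ_kf)(p₁)| ≤ (‖Q^{e*}_k‖²(d²(2R+2)^d)^{1/2}·8(d−1)R +
  c₀S(1 + 8(d−1)R))·‖f‖_∞`; `abs_ineq217_sigmaTorus_l2'` with the row sum discharged (`BIJ88Ineq217Torus.sum_plaq_exp_neg_pdist_le`).
HONEST SCOPE.  (2.16) for the kernel of the torus σ_k (row C2.Eq2.16; needs the propagator decay of [2]/[B5]) remains THE displayed
hypothesis `h216`; the constant is explicit but not the printed `1`; `ℓ²` reading of «bounded operator» as in gen 6; one torus at a time;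
no `def`, no new named fact; NOT summit progress.  Unit `lit-balaban-p08` (literature-prover-lit-balaban-p08-g7-0), 2026-08-21.
-/

open scoped BigOperators RealInnerProductSpace

namespace Literature.MathematicalPhysics.QuantumFieldTheory.BalabanImbrieJaffe1984to88.BIJ88Ineq217SigmaTorus

open Balaban1983to89 hiding Site Plaq
open Balaban1983to89.LatticeFieldCalculus Balaban1983to89.T4AxialGaugeSmallField
open BIJ88Sect2Statements BIJ88Ineq217Mechanism BIJ88Ineq217NearPart BIJ88Ineq217NearSupport BIJ88Ineq217Torus
open BIJ85AxialPropagator411 BIJ85Sigma421Torus BIJ85Sigma712Torus BIJ85NoZeroModes309Torus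
-- inside this namespace the bare `Site`/`Plaq` are the `ℤ^d` carriers of the QFT root; the torus ones are renamed:
open Balaban1983to89 renaming Site → TSite, Plaq → TPlaq

noncomputable section

/-! ## §1  A symmetric operator with `0 ≤ ⟨f, Tf⟩ ≤ C‖f‖²` has `‖Tf‖ ≤ C‖f‖` -/

section Form

variable {E : Type*} [NormedAddCommGroup E] [InnerProductSpace ℝ E]

/-- Cauchy–Schwarz for the nonnegative symmetric form `⟨·, T·⟩`: `⟨f, Tg⟩² ≤ ⟨f, Tf⟩⟨g, Tg⟩` (discriminant of
`t ↦ ⟨f + tg, T(f + tg)⟩ ≥ 0`) — the step behind «σ_k is a bounded operator» read from the form bounds of [2].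
[cite: BalabanImbrieJaffe1988, (2.17) p.262] -/
theorem inner_form_sq_le (T : E →ₗ[ℝ] E) (hsymm : ∀ f g : E, ⟪T f, g⟫ = ⟪f, T g⟫) (hpos : ∀ f : E, 0 ≤ ⟪f, T f⟫) (f g : E) :
    ⟪f, T g⟫ ^ 2 ≤ ⟪f, T f⟫ * ⟪g, T g⟫ := by
  have hq : ∀ t : ℝ, 0 ≤ ⟪g, T g⟫ * (t * t) + 2 * ⟪f, T g⟫ * t + ⟪f, T f⟫ := by
    intro t
    have h := hpos (f + t • g)
    have hgf : ⟪g, T f⟫ = ⟪f, T g⟫ := by rw [← hsymm g f, real_inner_comm]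
    rw [map_add, map_smul, inner_add_left, inner_add_right, inner_add_right, inner_smul_left, inner_smul_left, inner_smul_right,
      inner_smul_right, hgf] at h
    have : ⟪f, T f⟫ + t * ⟪f, T g⟫ + (t * ⟪f, T g⟫ + t * (t * ⟪g, T g⟫)) =
        ⟪g, T g⟫ * (t * t) + 2 * ⟪f, T g⟫ * t + ⟪f, T f⟫ := by ring
    simpa [this] using h
  have hd := discrim_le_zero hq
  rw [discrim] at hd
  nlinarith [hd]

/-- **The operator bound from the form bounds**: if `T` is symmetric with `0 ≤ ⟨f, Tf⟩ ≤ C‖f‖²` for all `f` (`0 ≤ C`), then `‖Tf‖ ≤ C‖f‖`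
(`‖Tf‖⁴ = ⟨f, T(Tf)⟩² ≤ ⟨f, Tf⟩⟨Tf, T(Tf)⟩ ≤ C‖f‖²·C‖Tf‖²`). [cite: BalabanImbrieJaffe1988, (2.17) p.262] -/
theorem norm_le_of_form_le (T : E →ₗ[ℝ] E) {C : ℝ} (hC : 0 ≤ C) (hsymm : ∀ f g : E, ⟪T f, g⟫ = ⟪f, T g⟫)
    (hpos : ∀ f : E, 0 ≤ ⟪f, T f⟫) (hle : ∀ f : E, ⟪f, T f⟫ ≤ C * ‖f‖ ^ 2) (f : E) : ‖T f‖ ≤ C * ‖f‖ := by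
  have h1 : ⟪f, T (T f)⟫ = ‖T f‖ ^ 2 := by rw [← hsymm, real_inner_self_eq_norm_sq]
  have h2 := inner_form_sq_le T hsymm hpos f (T f)
  rw [h1] at h2
  -- `‖Tf‖⁴ ≤ (C‖f‖²)(C‖Tf‖²)`
  have h3 : (‖T f‖ ^ 2) ^ 2 ≤ C * ‖f‖ ^ 2 * (C * ‖T f‖ ^ 2) :=
    h2.trans (mul_le_mul (hle f) (hle (T f)) (hpos _) (by positivity))
  by_cases hT : ‖T f‖ = 0
  · rw [hT]; positivity
  · have hTpos : 0 < ‖T f‖ := lt_of_le_of_ne (norm_nonneg _) (Ne.symm hT)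
    have h4 : ‖T f‖ ^ 2 ≤ (C * ‖f‖) ^ 2 := by nlinarith [h3, hTpos]
    exact (pow_le_pow_iff_left₀ (norm_nonneg _) (mul_nonneg hC (norm_nonneg f)) two_ne_zero).1 h4

end Form

/-! ## §2  «σ_k is a bounded operator» on the torus: `‖σ_kf‖ ≤ ‖Q^{e*}_k‖²‖f‖` -/

variable {P : Params}

/-- **«σ_k is a bounded operator on curls [2]» FOR THE TORUS σ_k OF RECORD** — in fact on ALL unit plaquette fields: `‖σ_kf‖ ≤ ‖Q^{e*}_k‖²_op‖f‖`,
from [2] = [I] (4.2.7) `0 ≤ ⟨f, σ_kf⟩ ≤ ‖Q^{e*}_kf‖²` on the torus (p30's `sigmaTorus_form_bounds`, no zero modes `hD_holds`) and the symmetry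
of σ_k (p33's `inner_sigmaTorus_comm`), by `norm_le_of_form_le`; `Q^{e*}_k` read as the continuous linear map `QesOp hd w k` (finite
dimension); `k ≤ m + K`, `c ≠ 0`, `w > 0`, `2 ≤ d`. [cite: BalabanImbrieJaffe1988, (2.17) p.262] -/
theorem norm_sigmaTorus_le (hd : 2 ≤ P.d) {k : ℕ} (hk : k ≤ P.m + P.K) {c : ℝ} (hc : c ≠ 0) {w : ℝ} (hw : 0 < w)
    (f : UnitPlaqSpace P k) :
    ‖sigmaTorus (P := P) hd w c k f‖ ≤ ‖LinearMap.toContinuousLinearMap (QesOp (P := P) hd w k)‖ ^ 2 * ‖f‖ := by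
  refine norm_le_of_form_le (sigmaTorus (P := P) hd w c k) (sq_nonneg _) (fun f g => inner_sigmaTorus_comm hd hk hw hc f g)
    (fun f => (sigmaTorus_form_bounds hd hw c k (hD_holds hk hc) f).1) (fun f => ?_) f
  refine (sigmaTorus_form_bounds hd hw c k (hD_holds hk hc) f).2.trans ?_
  have h := (LinearMap.toContinuousLinearMap (QesOp (P := P) hd w k)).le_opNorm f
  rw [LinearMap.coe_toContinuousLinearMap'] at h
  calc ‖QesOp (P := P) hd w k f‖ ^ 2 ≤ (‖LinearMap.toContinuousLinearMap (QesOp (P := P) hd w k)‖ * ‖f‖) ^ 2 :=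
        pow_le_pow_left₀ (norm_nonneg _) h 2
    _ = ‖LinearMap.toContinuousLinearMap (QesOp (P := P) hd w k)‖ ^ 2 * ‖f‖ ^ 2 := by ring

/-- The same in coordinates: `Σ_p (σ_kf)(p)² ≤ (‖Q^{e*}_k‖²)²·Σ_p f(p)²`. [cite: BalabanImbrieJaffe1988, (2.17) p.262] -/
theorem sum_sq_sigmaTorus_le (hd : 2 ≤ P.d) {k : ℕ} (hk : k ≤ P.m + P.K) {c : ℝ} (hc : c ≠ 0) {w : ℝ} (hw : 0 < w)
    (f : UnitPlaqSpace P k) :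
    ∑ p, (sigmaTorus (P := P) hd w c k f p) ^ 2 ≤
      (‖LinearMap.toContinuousLinearMap (QesOp (P := P) hd w k)‖ ^ 2) ^ 2 * ∑ p, (f p) ^ 2 := by
  rw [← EuclideanSpace.real_norm_sq_eq, ← EuclideanSpace.real_norm_sq_eq, ← mul_pow]
  exact pow_le_pow_left₀ (norm_nonneg _) (norm_sigmaTorus_le hd hk hc hw f) 2

/-! ## §3  The kernel of the torus σ_k and gen 6's hypothesis `hV2` -/

/-- Components are unchanged by p30's `toU`. [folklore] -/
private theorem toU_apply' (k : ℕ) (g : TPlaq P k → ℝ) (p : TPlaq P k) : toU P k g p = g p := rfl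

/-- A unit plaquette field is the sum of its coordinates times the coordinate fields `e_q = toU(δ_q)`.
[cite: BalabanImbrieJaffe1988, (2.17) p.262] -/
theorem toU_eq_sum_single (k : ℕ) (g : TPlaq P k → ℝ) :
    toU P k g = ∑ q, g q • toU P k (Pi.single q 1) := by
  have hg : g = ∑ q, g q • (Pi.single q (1 : ℝ) : TPlaq P k → ℝ) := by
    funext p
    rw [Finset.sum_apply, Finset.sum_eq_single p]
    · rw [Pi.smul_apply, Pi.single_eq_same, smul_eq_mul, mul_one]
    · intro q _ hq
      rw [Pi.smul_apply, Pi.single_eq_of_ne (Ne.symm hq), smul_zero]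
    · intro h; exact absurd (Finset.mem_univ p) h
  conv_lhs => rw [hg]
  rw [map_sum]
  refine Finset.sum_congr rfl fun q _ => ?_
  rw [map_smul]

/-- **The kernel of σ_k acts as σ_k**: with `σ(p, q) := (σ_ke_q)(p)` (`e_q = toU(δ_q)`), gen 6's `applyK σ g p = Σ_q σ(p,q)g(q)` IS `(σ_k(toU g))(p)`.
[cite: BalabanImbrieJaffe1988, (2.17) p.262] -/
theorem applyK_sigmaKernel (hd : 2 ≤ P.d) (w c : ℝ) (k : ℕ) (g : TPlaq P k → ℝ) (p : TPlaq P k) :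
    applyK (fun p q => sigmaTorus (P := P) hd w c k (toU P k (Pi.single q 1)) p) g p = sigmaTorus (P := P) hd w c k (toU P k g) p := by
  unfold applyK
  rw [toU_eq_sum_single, map_sum, WithLp.ofLp_sum, Finset.sum_apply]
  refine Finset.sum_congr rfl fun q _ => ?_
  rw [map_smul, WithLp.ofLp_smul, Pi.smul_apply, smul_eq_mul, mul_comm]

/-- **gen 6's hypothesis `hV2` («σ_k is a bounded operator on curls», `ℓ²` reading) HOLDS for the kernel of the torus σ_k**, with
`M = ‖Q^{e*}_k‖²_op` and for EVERY `g` (so on `Set.range (curl c′)` for any `c′`): `Σ_p (applyK σ g p)² ≤ M²Σ_p g(p)²`; `k ≤ m + K`, `c ≠ 0`,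
`w > 0`, `2 ≤ d`. [cite: BalabanImbrieJaffe1988, (2.17) p.262] -/
theorem hV2_sigmaTorus (hd : 2 ≤ P.d) {k : ℕ} (hk : k ≤ P.m + P.K) {c : ℝ} (hc : c ≠ 0) {w : ℝ} (hw : 0 < w) (c' : ℝ) :
    ∀ g ∈ Set.range (curl c' : VecField P k ℝ → TPlaq P k → ℝ),
      ∑ p, applyK (fun p q => sigmaTorus (P := P) hd w c k (toU P k (Pi.single q 1)) p) g p ^ 2 ≤
        (‖LinearMap.toContinuousLinearMap (QesOp (P := P) hd w k)‖ ^ 2) ^ 2 * ∑ p, g p ^ 2 := by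
  intro g _
  simp only [applyK_sigmaKernel]
  have h := sum_sq_sigmaTorus_le hd hk hc hw (toU P k g)
  simpa only [toU_apply'] using h

/-! ## §4  (2.17) on the torus for the σ_k of record -/

/-- **(2.17) ON THE TORUS FOR THE σ_k OF RECORD** p. 262: for p30's `σ_k = sigmaTorus hd w c k` ((I.4.2.1)–(I.4.2.2)), a unit plaquette field
`f` with `f = ∂^{c′}A` on the plaquettes of the box of radius `R` about `p₁.src = castSite z₁` (print's *"f^{(k)}(p₂) = (∂A)(p₂) for p₂ near p₁"*,
any curl constant `c′ ≠ 0`, `2R < sitesPerDir k`), and (2.16) for the kernel `σ(p₁, p₂) = (σ_ke_{p₂})(p₁)` beyond `R` with row sum `S`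
(`h216`, `hS` — row C2.Eq2.16, displayed): `|(σ_kf)(p₁)| ≤ (‖Q^{e*}_k‖²_op·(d²(2R+2)^d)^{1/2}·8(d−1)R + c₀S(1 + 8(d−1)R))·‖f‖_∞` — gen 6's
`BIJ88Ineq217NearSupport.abs_ineq217_torus_l2` with its hypothesis `hV2` («σ_k is a bounded operator on curls [2]») DISCHARGED by
`hV2_sigmaTorus`; `k ≤ m + K`, `c ≠ 0`, `w > 0`, `2 ≤ d`. [cite: BalabanImbrieJaffe1988, (2.17) p.262] -/
theorem abs_ineq217_sigmaTorus_l2 (hd : 2 ≤ P.d) {k : ℕ} (hk : k ≤ P.m + P.K) {c : ℝ} (hc : c ≠ 0) {w : ℝ} (hw : 0 < w)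
    {c₀ δ S c' : ℝ} (hc₀ : 0 ≤ c₀) (hc' : c' ≠ 0) {R : ℕ} (hR : 2 * R < P.sitesPerDir k) {p₁ : TPlaq P k} {z₁ : Fin P.d → ℤ}
    (h₁ : p₁.src = castSite z₁)
    (h216 : ∀ p₂, (R : ℝ) ≤ pdist p₁ p₂ →
      |sigmaTorus (P := P) hd w c k (toU P k (Pi.single p₂ 1)) p₁| ≤ c₀ * Real.exp (-δ * pdist p₁ p₂))
    (hS : ∑ p₂, Real.exp (-δ * pdist p₁ p₂) ≤ S)
    {f : TPlaq P k → ℝ} {A : VecField P k ℝ} (hf : ∀ p ∈ boxPlaqs (loOf z₁ R) (hiOf z₁ R), f p = curl c' A p) :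
    |sigmaTorus (P := P) hd w c k (toU P k f) p₁| ≤
      (‖LinearMap.toContinuousLinearMap (QesOp (P := P) hd w k)‖ ^ 2 * Real.sqrt ((P.d * P.d * (2 * R + 2) ^ P.d : ℕ) : ℝ) *
          (8 * ((P.d - 1 : ℕ) : ℝ) * R) + c₀ * S * (1 + 8 * ((P.d - 1 : ℕ) : ℝ) * R)) * supNorm f := by
  rw [← applyK_sigmaKernel hd w c k f p₁]
  exact abs_ineq217_torus_l2 (σ := fun p q => sigmaTorus (P := P) hd w c k (toU P k (Pi.single q 1)) p) hc₀ (sq_nonneg _) hc' hR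
    h₁ h216 hS (hV2_sigmaTorus hd hk hc hw c') hf

/-- **(2.17) on the torus for the σ_k of record, row sum discharged** (`δ > 0`, `S = d²(2(1+δ⁻¹))^d`, gen 6's
`BIJ88Ineq217Torus.sum_plaq_exp_neg_pdist_le`): only (2.16) for the kernel of σ_k remains displayed. [cite: BalabanImbrieJaffe1988, (2.17) p.262] -/
theorem abs_ineq217_sigmaTorus_l2' (hd : 2 ≤ P.d) {k : ℕ} (hk : k ≤ P.m + P.K) {c : ℝ} (hc : c ≠ 0) {w : ℝ} (hw : 0 < w)
    {c₀ δ c' : ℝ} (hc₀ : 0 ≤ c₀) (hδ : 0 < δ) (hc' : c' ≠ 0) {R : ℕ} (hR : 2 * R < P.sitesPerDir k) {p₁ : TPlaq P k}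
    {z₁ : Fin P.d → ℤ} (h₁ : p₁.src = castSite z₁)
    (h216 : ∀ p₂, (R : ℝ) ≤ pdist p₁ p₂ →
      |sigmaTorus (P := P) hd w c k (toU P k (Pi.single p₂ 1)) p₁| ≤ c₀ * Real.exp (-δ * pdist p₁ p₂))
    {f : TPlaq P k → ℝ} {A : VecField P k ℝ} (hf : ∀ p ∈ boxPlaqs (loOf z₁ R) (hiOf z₁ R), f p = curl c' A p) :
    |sigmaTorus (P := P) hd w c k (toU P k f) p₁| ≤
      (‖LinearMap.toContinuousLinearMap (QesOp (P := P) hd w k)‖ ^ 2 * Real.sqrt ((P.d * P.d * (2 * R + 2) ^ P.d : ℕ) : ℝ) *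
          (8 * ((P.d - 1 : ℕ) : ℝ) * R) +
        c₀ * ((P.d : ℝ) * P.d * (2 * (1 + δ⁻¹)) ^ P.d) * (1 + 8 * ((P.d - 1 : ℕ) : ℝ) * R)) * supNorm f :=
  abs_ineq217_sigmaTorus_l2 hd hk hc hw hc₀ hc' hR h₁ h216 (sum_plaq_exp_neg_pdist_le hδ p₁) hf

end

end Literature.MathematicalPhysics.QuantumFieldTheory.BalabanImbrieJaffe1984to88.BIJ88Ineq217SigmaTorus
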